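import Summits.ABC.IUTFork.Joshi.ATS4RowsCEFGenuineTowerOfNumberFields
import Summits.ABC.IUTFork.Joshi.ATS4WildBoundLpInitialThetaData
import HarnessLib

/-!
# [J-IV] (arXiv:2403.10430v2) Lemma 6.7.1, clause (i) «`30ℓ ∣ disc L′`»: WHICH field binder contains `F(E_F[ℓ])` — the rows'
# `hKℓ` IS «`K ⊇ F(E_F[ℓ])`» in p486541's own currency (its discharge fires VERBATIM at the genuine tower, at Joshi's `L′`, at the
# `K` of any initial Θ-data), while the E5 spine's `hK` alone is met at `K := F`, where «`K ⊇ F(E_F[ℓ])`» FAILS under (P6)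

Proof-only companion (0 defs) of the abc-iut cell, R-J «Joshi Y-discharge census» rows **Y-21c / Y-21e / Y-21f**, clause (i),
E-ROW **R-30** «HONEST-SCOPE bridge» (rung LADDER-ABC:A2.E / A2.RESCUE.J), seat abc-iut-E-t27 (gen 10; lineage p467957
`ATS4WildBoundLpInitialThetaData`, whose §3 gives `Gal(F̄/K) = Ker ρ̄_{E_F,ℓ}` for initial Θ-data). SOURCES: K. Joshi, *Construction
of Arithmetic Teichmüller Spaces IV*, arXiv:2403.10430v2 (unrefereed; bib `Joshi2024ATS4`), Lemma 6.6.1 + proof p.60 l.63 – p.61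
l.12 («`L′ ⊃ ℚ(ζ_{60·ℓ})`», p.61 l.10–11), Lemma 6.7.1 p.61 l.24–30, §6.6 p.60 l.56–62; [J-III] (arXiv:2401.13508v4) §3.3 (13)
p.28 l.11 («`L′` … the fixed field of the kernel of `ρ_{C/L;ℓ}`»); S. Mochizuki, *IUT IV*, proof of Thm. 1.10 Step (v) p.25 l.5–7 («`K` contains a
primitive `4·3·5·l`-th root of unity, hence is ramified over `ℚ` at any valuation … that divides `2·3·5·l`»); *IUT I* Def. 3.1 (c).
Page/line = the cell's renders `HOME/lit/renders/`.

WHAT WAS OPEN (R-30). abc-iut-E-cx-3's p486541 `ATS4Reading3DiscOddPart` discharged clause (i) at the reading `L′ ⊇ F(E_F[ℓ])` in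
`Γ_F`/`ψ`-currency (`dvd_discr_of_fixing_torsion_thetaCurve`: every `τ ∈ Γ_F` fixing `ψ(K)` fixes `E_F[ℓ](F̄)`), noting (HONEST SCOPE)
that the E5 residual binders' `K` (E-t33 `abc_of_genuineResidualSupport`: `hK : ker ρ̄ ≤ Gal(F̄/ψ(K))`, «`ψ(K) ⊆ F(E_F[ℓ])`») carries
the OPPOSITE inclusion; E-t24's p489308 re-proved the `ℓ`-part from the rows' binder `hKℓ` («`Γ_K` fixes `E_K[ℓ](K̄)`»,
`Γ_K`-currency). Asked: in the genuine tower, does the field binder contain `F(E_F[ℓ])` — and does the E5 binder?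

WHAT IS PROVED (theorems only; standard axioms; no `sorry`, instance, notation, `def` or new `Prop`; FACT rows: none).
* §1 THE TWO CURRENCIES COINCIDE, for ANY Weierstrass curve `W/L` and abstract `K` with `ψ : K →ₐ[L] L̄`: «`Γ_K` fixes
  `(W ⊗_L K)[n](K̄)`» ⟹ `Gal(L̄/ψ(K)) ≤ ker ρ̄_{W,n}` (`fieldRange_fixingSubgroup_le_ker_of_forall_smul_geomTorsion_map_eq`: transport
  along `L̄ ≅_K K̄`, the CONVERSE of abc-iut-E-t35's p466034); `≤ ker` ⟺ the pointwise shape (`le_ker_galoisRepTorsion_iff_forall_smul_eq`).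
* §2 AT THE LEGENDRE THETA CURVE: the rows' `hKℓ` ⟺ `Gal(F̄/ψ(K)) ≤ ker ρ̄_{E_F,ℓ}` (`geomTorsion_rational_iff_le_ker`) ⟹ p486541's
  hypothesis VERBATIM (`fixing_torsion_of_geomTorsion_rational`); p489786's two binder sets are ONE: `ψ.fieldRange = F(E_F[ℓ])` ⟺
  `hK ∧ hKℓ` (`fieldRange_eq_divisionField_iff`; ⟹ was E-t35's p467607).
* §3 THE DISCHARGE VERBATIM: p486541's `Γ_F`-currency theorem FIRES on the rows' binder (`ell_dvd_discr_of_geomTorsion_rational_via_fixing`),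
  and AT THE GENUINE TOWER `PrimeTowerDatum.ofNumberFields L_mod L_tpd M L K S e* ℓ` (E-t31 p489283) **every prime of `2·3·5·ℓ` lies in
  `V^dst_ℚ`** — Lemma 6.7.1 (3) ⟹ (1) at the primes of `30ℓ` — under `hKℓ` resp. `ψ.fieldRange = F(E_F[ℓ])`, with NO (P2), NO Galois
  hypothesis, NO `ℓ ≥ 7` (`primeFactors_thirtyL_subset_vdstQ_ofNumberFields`, `…_of_fieldRange_eq_divisionField`).
* §4 MOCHIZUKI'S OWN DATUM: for the `K` of ANY `InitialThetaData F K F̄ E_F ℓ Pb` ([IUTchI] Def. 3.1 as typed) over the Legendre curve: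
  `hKℓ` HOLDS (`geomTorsion_rational_of_initialThetaData`) and every prime of `2·3·5·ℓ` divides `disc K`
  (`thirtyL_clause_of_initialThetaData`) — [IUTchIV] p.25 l.5–7 in kernel at Def. 3.1's data.
* §5 LOCATED — the E5 binder ALONE: the field binders of `abc_of_genuineResidualSupport` / `_reading3` / `abc_of_genuineResidual`
  (`K/F` Galois number field over `F_tpd`, `ψ`, `hK`) are met at the BOTTOM FIELD `K := F`, `ψ := Algebra.ofId`
  (`ker_le_fixingSubgroup_fieldRange_ofId`: `Gal(F̄/F) = Γ_F ≥ ker ρ̄`),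
  and there, under the spine's own GIVEN (P6) ⊂ `ITDConditions` (= Def. 3.1 (c) «image ⊇ SL₂(𝔽_ℓ)»), «`K ⊇ F(E_F[ℓ])`» is FALSE in
  both currencies (`not_le_ker_at_base_of_condP6`, `not_geomTorsion_rational_at_base_of_condP6`,
  `exists_spine_fieldBinders_not_le_ker_of_itdConditions`: `[Γ_F : Ker ρ̄] ≥ ℓ(ℓ²−1) ≥ 6`, p467957 §1). So «`K ⊇ F(E_F[ℓ])`» is NOT a
  consequence of the E5 binders; it is the binder `hKℓ`/`hψ` of the tree's consumers of clause (i) as a hypothesis on `disc K` — rows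
  c/e/f at the genuine `V^dst_ℚ` (p465152's `h30`, discharged p489308, composed p489786) — where §3 discharges it; the spine itself
  consumes no discriminant clause (its `V` admits the primes of `30ℓ` through the disjunct `q ∣ 2·3·5·ℓ`, E-t24
  `GenuineVdst.threeWay_of_mem_reading3`).

RUNG CURRENCY (R-30; the word is abc-iut-E-plan's pen; no census count moves): KEEP-half §1–§4, KILL-half §5. FRAMING (binding): classical
arithmetic (Galois theory of `F̄`, the Weil pairing, Dedekind's discriminant theorem — PROVED in the tree / Mathlib) composed with the cell's
PROVED statements BY NAME; DEFS-FREEZE respected (imports only). NO side is taken on [IUTchIII] Cor. 3.12 / [IUTchIV] Thm. 1.10, on Joshi's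
claims or on Mochizuki's report on them; NOT a test verdict; NOT an abc claim; typed ≠ proved ≠ endorsed. [claim: Joshi2024ATS4, status: disputed].
-/

noncomputable section

open scoped Classical

open Finset NumberField IsDedekindDomain
open Literature.IUT.LogVolume Literature.IUT.LogVolume.Cor22
open Literature.NumberTheory.DiophantineGeometry Literature.NumberTheory.DiophantineGeometry.GenEll
open Literature.NumberTheory.EllipticCurves Literature.IUT.HodgeTheaters
open WeierstrassCurve

namespace Summit.ABC.IUTFork.Joshi.ATS4

universe u v

namespace GenuineVdst

/-! ## 1. The two currencies coincide: «`Γ_K` fixes `(W ⊗_L K)[n](K̄)`» ⟹ «`Gal(L̄/ψ(K)) ≤ ker ρ̄_{W,n}`» (⟸ is p466034) -/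

section Currency

variable {L : Type u} [Field L] (W : WeierstrassCurve L) (n : ℕ)
variable {K : Type v} [Field K] [Algebra L K] (ψ : K →ₐ[L] AlgebraicClosure L)

/-- Unfolding: a subgroup `H ≤ Γ_L` lies in `ker ρ̄_{W,n}` iff every `τ ∈ H` fixes every point of `W(L̄)` killed by `n` (the tree's
`coe_ker_galoisRepTorsion`: the kernel is the pointwise stabiliser of `E[n]`) — the passage between «`≤ ker`» and p486541's pointwise
hypothesis shape. [folklore] -/
theorem le_ker_galoisRepTorsion_iff_forall_smul_eq (H : Subgroup (AlgebraicClosure L ≃ₐ[L] AlgebraicClosure L)) :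
    H ≤ (W.galoisRepTorsion (n : ℤ)).ker ↔
      ∀ τ : Field.absoluteGaloisGroup L, τ ∈ H → ∀ T : W.geomPoints, (n : ℤ) • T = 0 → τ • T = T := by
  constructor
  · intro h τ hτ T hT
    have hmem : τ ∈ ((W.galoisRepTorsion (n : ℤ)).ker : Set (Field.absoluteGaloisGroup L)) := h hτ
    rw [coe_ker_galoisRepTorsion, Set.mem_iInter] at hmem
    exact hmem ⟨T, (Submodule.mem_torsionBy_iff (n : ℤ) T).mpr hT⟩
  · intro h τ hτ
    have hmem : ∀ σ : Field.absoluteGaloisGroup L, σ ∈ H →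
        σ ∈ ((W.galoisRepTorsion (n : ℤ)).ker : Set (Field.absoluteGaloisGroup L)) := by
      intro σ hσ
      rw [coe_ker_galoisRepTorsion, Set.mem_iInter]
      exact fun T => h σ hσ T ((Submodule.mem_torsionBy_iff (n : ℤ) (T : W.geomPoints)).mp T.2)
    exact hmem τ hτ

/-- **«`Γ_K` fixes `(W ⊗_L K)[n](K̄)`» ⟹ «`Gal(L̄/ψ(K)) ≤ ker ρ̄_{W,n}`»** for an abstract `K` with an `L`-embedding `ψ : K → L̄`
(`L̄ = AlgebraicClosure L`, `K̄ = AlgebraicClosure K` — two different algebraic closures): the CONVERSE of abc-iut-E-t35's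
`WeierstrassCurve.forall_smul_geomTorsion_map_eq_of_fieldRange_fixingSubgroup_le` (p466034). A `τ ∈ Gal(L̄/ψ(K))` is `K`-linear on
`L̄`; push it forward along a `K`-isomorphism `ι : L̄ ≅ K̄` (`IsAlgClosure.equiv`): `ιτι⁻¹ ∈ Γ_K` fixes `ι(T)`,
`ι(τ•T) = (ιτι⁻¹)•ι(T)`, and transport of points is injective. [cite: SilvermanAEC2009, VIII.§1] [cite: MochizukiGenEll2010, Thm 3.8 p.20] -/
theorem fieldRange_fixingSubgroup_le_ker_of_forall_smul_geomTorsion_map_eq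
    (h : ∀ (σ' : Field.absoluteGaloisGroup K) (Q : (W.map (algebraMap L K)).geomTorsion (n : ℤ)), σ' • Q = Q) :
    ψ.fieldRange.fixingSubgroup ≤ (W.galoisRepTorsion (n : ℤ)).ker := by
  refine (le_ker_galoisRepTorsion_iff_forall_smul_eq W n _).mpr fun τ hτ T hT => ?_
  -- the two algebraic closures; `Ω = L̄` is an algebraic closure of `K` through `ψ`
  let Ω := AlgebraicClosure L
  let K' := AlgebraicClosure K
  letI : Algebra K Ω := ψ.toRingHom.toAlgebra
  haveI : IsScalarTower L K Ω := IsScalarTower.of_algebraMap_eq fun x => (ψ.commutes x).symm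
  haveI : Algebra.IsAlgebraic K Ω := Algebra.IsAlgebraic.tower_top (K := L) K
  haveI : IsAlgClosure K Ω :=
    { isAlgClosed := inferInstanceAs (IsAlgClosed (AlgebraicClosure L))
      isAlgebraic := inferInstance }
  let ι : Ω ≃ₐ[K] K' := IsAlgClosure.equiv K Ω K'
  let ιL : Ω ≃ₐ[L] K' := ι.restrictScalars L
  let W' : WeierstrassCurve K := W.map (algebraMap L K)
  -- transport of geometric points along `ι` and `ι⁻¹`
  let Tm : W.geomPoints →+ W'.geomPoints := Affine.Point.map (W' := W) (ιL : Ω →ₐ[L] K')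
  let Ti : W'.geomPoints →+ W.geomPoints := Affine.Point.map (W' := W) (ιL.symm : K' →ₐ[L] Ω)
  have hmap_id : ∀ x : W.geomPoints, Affine.Point.map (W' := W) (AlgHom.id L Ω) x = x :=
    fun x => by cases x <;> rfl
  have hTiTm : ∀ x, Ti (Tm x) = x := fun x => by
    change Affine.Point.map (W' := W) (ιL.symm : K' →ₐ[L] Ω)
      (Affine.Point.map (W' := W) (ιL : Ω →ₐ[L] K') x) = x
    rw [Affine.Point.map_map, AlgEquiv.symm_comp, hmap_id]
  -- `τ`, read as an `L`-algebra automorphism of `Ω`, fixes `ψ(K)` pointwise, i.e. is `K`-linear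
  let τe : Ω ≃ₐ[L] Ω := τ
  have hτK : ∀ k : K, τe (algebraMap K Ω k) = algebraMap K Ω k := by
    intro k
    have hτ' : τe ∈ ψ.fieldRange.fixingSubgroup := hτ
    rw [IntermediateField.mem_fixingSubgroup_iff] at hτ'
    exact hτ' _ ⟨k, rfl⟩
  let τK : Ω ≃ₐ[K] Ω := { τe with commutes' := hτK }
  -- push `τ` forward to `K̄`: an element of `Γ_K`
  let σe : K' ≃ₐ[K] K' := ι.symm.trans (τK.trans ι)
  let σA : Field.absoluteGaloisGroup K := σe
  -- `Tm T` is an `n`-torsion point of `W'` over `K̄`, hence fixed by `σA`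
  have hQmem : Tm T ∈ W'.geomTorsion (n : ℤ) := by
    refine (Submodule.mem_torsionBy_iff (n : ℤ) _).mpr ?_
    change (n : ℤ) • Tm T = 0
    rw [← map_zsmul, hT, map_zero]
  have hfix : σA • Tm T = Tm T := by
    have h1 := congrArg Subtype.val (h σA ⟨Tm T, hQmem⟩)
    rwa [AddSubgroup.torsionBy.coe_smul] at h1
  -- the action of `σA` on `Tm T` is the transport of the action of `τ` on `T`
  have hactP' : ∀ y : W'.geomPoints, σA • y =
      Affine.Point.map (W' := W) ((σe.restrictScalars L : K' ≃ₐ[L] K') : K' →ₐ[L] K') y :=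
    fun y => by cases y <;> rfl
  have hactP : ∀ x : W.geomPoints, τ • x = Affine.Point.map (W' := W) (τe : Ω →ₐ[L] Ω) x :=
    fun x => by cases x <;> rfl
  have hcomp : ((σe.restrictScalars L : K' ≃ₐ[L] K') : K' →ₐ[L] K').comp (ιL : Ω →ₐ[L] K') =
      (ιL : Ω →ₐ[L] K').comp (τe : Ω →ₐ[L] Ω) := by
    ext z
    change ι (τK (ι.symm (ι z))) = ι (τe z)
    rw [AlgEquiv.symm_apply_apply]
    rfl
  have key : σA • Tm T = Tm (τ • T) := by
    rw [hactP', hactP]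
    change Affine.Point.map (W' := W) ((σe.restrictScalars L : K' ≃ₐ[L] K') : K' →ₐ[L] K')
        (Affine.Point.map (W' := W) (ιL : Ω →ₐ[L] K') T) =
      Affine.Point.map (W' := W) (ιL : Ω →ₐ[L] K') (Affine.Point.map (W' := W) (τe : Ω →ₐ[L] Ω) T)
    rw [Affine.Point.map_map, Affine.Point.map_map, hcomp]
  -- conclude by injectivity of the transport (apply `ι⁻¹`)
  rw [key] at hfix
  have h2 := congrArg Ti hfix
  rwa [hTiTm, hTiTm] at h2

end Currency

/-! ## 2. At the Legendre theta curve: the rows' `hKℓ` IS «`K ⊇ F(E_F[ℓ])`» in p486541's currency; p489786's two binder sets are one -/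

section Theta

variable {P : NFPoint} {F : Type} [Field F] [NumberField F] [Algebra P.F F]
variable {K : Type} [Field K] [NumberField K] [Algebra F K] [Algebra P.F K] [IsScalarTower P.F F K]
variable (ψ : K →ₐ[F] AlgebraicClosure F)

/-- **`hKℓ` ⟹ `Gal(F̄/ψ(K)) ≤ ker ρ̄_{E_F,ℓ}`** («`K ⊇ F(E_F[ℓ])`» in `Γ_F`-currency) for the Legendre curve of `λ` (`E_F ⊗_F K = E_K`,
E-t35's `thetaCurve_baseChange`). [claim: Joshi2024ATS3, status: disputed] [cite: SilvermanAEC2009, VIII.§1] -/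
theorem le_ker_of_geomTorsion_rational {ℓ : ℕ}
    (hKℓ : ∀ (σ : Field.absoluteGaloisGroup K) (Q : WeierstrassCurve.geomTorsion (thetaCurve P K) (ℓ : ℤ)), σ • Q = Q) :
    ψ.fieldRange.fixingSubgroup ≤ ((thetaCurve P F).galoisRepTorsion (ℓ : ℤ)).ker := by
  refine fieldRange_fixingSubgroup_le_ker_of_forall_smul_geomTorsion_map_eq (thetaCurve P F) ℓ ψ ?_
  rw [show (thetaCurve P F).map (algebraMap F K) = thetaCurve P K from thetaCurve_baseChange (F := F) (K := K)]
  exact hKℓ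

/-- **The rows' binder `hKℓ` ⟺ «`K ⊇ F(E_F[ℓ])`» in `Γ_F`/`ψ`-currency** (⟸ is E-t35's p467607 §1).
[claim: Joshi2024ATS3, status: disputed] [cite: SilvermanAEC2009, VIII.§1] -/
theorem geomTorsion_rational_iff_le_ker {ℓ : ℕ} :
    (∀ (σ : Field.absoluteGaloisGroup K) (Q : WeierstrassCurve.geomTorsion (thetaCurve P K) (ℓ : ℤ)), σ • Q = Q) ↔
      ψ.fieldRange.fixingSubgroup ≤ ((thetaCurve P F).galoisRepTorsion (ℓ : ℤ)).ker :=
  ⟨le_ker_of_geomTorsion_rational ψ, forall_smul_geomTorsion_eq_of_fieldRange_fixingSubgroup_le ψ⟩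

/-- **The rows' binder `hKℓ` yields p486541's hypothesis VERBATIM**: every `τ ∈ Γ_F` fixing `ψ(K)` pointwise fixes every point of
`E_F(F̄)` killed by `ℓ` — the hypothesis `hK` of abc-iut-E-cx-3's `dvd_discr_of_fixing_torsion_thetaCurve`, literally.
[claim: Joshi2024ATS4, status: disputed] -/
theorem fixing_torsion_of_geomTorsion_rational {ℓ : ℕ}
    (hKℓ : ∀ (σ : Field.absoluteGaloisGroup K) (Q : WeierstrassCurve.geomTorsion (thetaCurve P K) (ℓ : ℤ)), σ • Q = Q) :
    ∀ τ : Field.absoluteGaloisGroup F, τ ∈ ψ.fieldRange.fixingSubgroup →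
      ∀ T : WeierstrassCurve.geomPoints (thetaCurve P F), (ℓ : ℤ) • T = 0 → τ • T = T :=
  (le_ker_galoisRepTorsion_iff_forall_smul_eq (thetaCurve P F) ℓ _).mp (le_ker_of_geomTorsion_rational ψ hKℓ)

/-- **p489786's two binder sets are ONE**: `ψ.fieldRange = F(E_F[ℓ])` (Joshi's ACTUAL `L′`, [J-III] (13)) ⟺ `hK ∧ hKℓ` (the cell's
«`K ⊆ L′`» and the rows' «`K ⊇ L′`»), `λ ∈ U`, `ℓ ≠ 0`. ⟹ is E-t35's p467607; ⟸: both fixing groups equal `ker ρ̄_{E_F,ℓ}`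
(`fixingSubgroup_divisionField_eq_ker`) and the Galois correspondence of `F̄/F` (Mathlib `InfiniteGalois.fixedField_fixingSubgroup`).
[claim: Joshi2024ATS3, status: disputed] [cite: SilvermanAEC2009, VIII.§1] -/
theorem fieldRange_eq_divisionField_iff (hU : P.InU) {ℓ : ℕ} [NeZero ℓ] :
    ψ.fieldRange = (thetaCurve P F).divisionField ℓ ↔
      ((thetaCurve P F).galoisRepTorsion (ℓ : ℤ)).ker ≤ ψ.fieldRange.fixingSubgroup ∧
        ∀ (σ : Field.absoluteGaloisGroup K) (Q : WeierstrassCurve.geomTorsion (thetaCurve P K) (ℓ : ℤ)), σ • Q = Q := by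
  refine ⟨fun hψ => ⟨(ker_le_and_le_ker_of_fieldRange_eq_divisionField ψ hU hψ).1,
    forall_smul_geomTorsion_eq_of_fieldRange_eq_divisionField ψ hU hψ⟩, fun h => ?_⟩
  haveI := thetaCurve_isElliptic hU F
  haveI : IsGalois F (AlgebraicClosure F) := {}
  have heq : ψ.fieldRange.fixingSubgroup = ((thetaCurve P F).divisionField ℓ).fixingSubgroup := by
    rw [(thetaCurve P F).fixingSubgroup_divisionField_eq_ker ℓ]
    exact le_antisymm (le_ker_of_geomTorsion_rational ψ h.2) h.1
  rw [← InfiniteGalois.fixedField_fixingSubgroup ψ.fieldRange, heq, InfiniteGalois.fixedField_fixingSubgroup]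

/-! ## 3. The discharge VERBATIM on the rows' binder, and clause (i) AT THE GENUINE TOWER's `V^dst_ℚ` -/

include ψ in
/-- **p486541's `Γ_F`-currency discharge FIRES on the rows' binder `hKℓ`**: `ℓ ∣ disc K` for `λ ∈ U`, `ℓ` an odd prime, `K ⊇ F` with
`hKℓ`, by `dvd_discr_of_fixing_torsion_thetaCurve … ψ` ITSELF, its hypothesis supplied by §2 (concordant with p489308's `Γ_K`-route
`mem_primeFactors_discr_of_geomTorsion_rational`). [claim: Joshi2024ATS4, status: disputed] [cite: SilvermanAEC2009, Cor. III.8.1.1] -/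
theorem ell_dvd_discr_of_geomTorsion_rational_via_fixing (hU : P.InU) {ℓ : ℕ} (hℓ : ℓ.Prime) (hℓ2 : ℓ ≠ 2)
    (hKℓ : ∀ (σ : Field.absoluteGaloisGroup K) (Q : WeierstrassCurve.geomTorsion (thetaCurve P K) (ℓ : ℤ)), σ • Q = Q) :
    (ℓ : ℤ) ∣ discr K :=
  dvd_discr_of_fixing_torsion_thetaCurve hU hℓ hℓ2 ψ (fixing_torsion_of_geomTorsion_rational ψ hKℓ)

variable (Lmod Ltpd M L : Type) [Field Lmod] [NumberField Lmod] [Field Ltpd] [NumberField Ltpd]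
  [Field M] [NumberField M] [Field L] [NumberField L]
  [Algebra Lmod Ltpd] [Algebra Ltpd M] [Algebra M K] [Algebra Ltpd L] [Algebra L K] [Algebra Ltpd K]
  [IsScalarTower Ltpd M K] [IsScalarTower Ltpd L K]
  (S : Finset (HeightOneSpectrum (𝓞 Lmod))) (estar : ℕ)

omit [IsScalarTower P.F F K] in
/-- **CLAUSE (i) AT THE GENUINE TOWER — every prime of `2·3·5·ℓ` lies in `V^dst_ℚ` of `PrimeTowerDatum.ofNumberFields L_mod L_tpd M L K S e* ℓ`**
(E-t31 p489283: there `V^dst_ℚ` IS «some place of the top field `K` over `p` is ramified over `ℚ`» = «`p` prime, `p ∣ disc K`»,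
`mem_vdstQ_ofNumberFields_iff_dvd_discr`), for `λ ∈ U`, `F` a theta field, `K ⊇ F` with the rows' `hKℓ`, `ℓ` an odd prime: [J-IV] Lemma
6.7.1 (3) ⟹ (1) at the primes of `30ℓ` — NO (P2), NO Galois hypothesis, NO `ℓ ≥ 7` (p489308 §1 `thirtyL_clause_of_geomTorsion_rational`).
[claim: Joshi2024ATS4, status: disputed] -/
theorem primeFactors_thirtyL_subset_vdstQ_ofNumberFields (hU : P.InU) (hF : IsThetaField P F) {ℓ : ℕ} (hℓ : ℓ.Prime) (hℓ2 : ℓ ≠ 2)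
    (hKℓ : ∀ (σ : Field.absoluteGaloisGroup K) (Q : WeierstrassCurve.geomTorsion (thetaCurve P K) (ℓ : ℤ)), σ • Q = Q) :
    ∀ p ∈ (2 * 3 * 5 * ℓ).primeFactors, p ∈ (PrimeTowerDatum.ofNumberFields Lmod Ltpd M L K S estar ℓ).VdstQ := by
  intro p hp
  have h := thirtyL_clause_of_geomTorsion_rational hU hF hℓ hℓ2 hKℓ p hp
  rw [PrimeTowerDatum.mem_vdstQ_ofNumberFields_iff_dvd_discr]
  exact ⟨Nat.prime_of_mem_primeFactors h, Int.natAbs_dvd_natAbs.mp (by simpa using Nat.dvd_of_mem_primeFactors h)⟩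

/-- The same at Joshi's ACTUAL `L′` (`ψ.fieldRange = F(E_F[ℓ])`, p489786's second form; `ℓ` an odd prime): every prime of `2·3·5·ℓ` lies
in `V^dst_ℚ` of the genuine tower with top field `K`. [claim: Joshi2024ATS4, status: disputed] -/
theorem primeFactors_thirtyL_subset_vdstQ_ofNumberFields_of_fieldRange_eq_divisionField (hU : P.InU) (hF : IsThetaField P F)
    {ℓ : ℕ} (hℓ : ℓ.Prime) (hℓ2 : ℓ ≠ 2) (hψ : ψ.fieldRange = (thetaCurve P F).divisionField ℓ) :
    ∀ p ∈ (2 * 3 * 5 * ℓ).primeFactors, p ∈ (PrimeTowerDatum.ofNumberFields Lmod Ltpd M L K S estar ℓ).VdstQ :=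
  haveI : NeZero ℓ := ⟨hℓ.ne_zero⟩
  primeFactors_thirtyL_subset_vdstQ_ofNumberFields Lmod Ltpd M L S estar hU hF hℓ hℓ2
    (forall_smul_geomTorsion_eq_of_fieldRange_eq_divisionField ψ hU hψ)

end Theta

/-! ## 4. Mochizuki's own datum: the `K` of ANY initial Θ-data ([IUTchI] Def. 3.1 as typed) satisfies the rows' `hKℓ` -/

section Datum

variable {P : NFPoint} {F : Type} [Field F] [NumberField F] [Algebra P.F F]
variable {K : Type} [Field K] [NumberField K] [Algebra F K] [Algebra P.F K] [IsScalarTower P.F F K]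
variable {Fbar : Type} [Field Fbar] [Algebra F Fbar] [Algebra K Fbar] {ℓ : ℕ} {Pb : BadPlacePredicates K}

/-- **`hKℓ` HOLDS for the `K` of ANY initial Θ-data over the Legendre curve** (`InitialThetaData F K F̄ E_F ℓ Pb`): Def. 3.1 (c) «`K` …
determined by the kernel» gives `Gal(F̄/ψ(K)) ≤ Ker ρ̄_{E_F,ℓ}` for `ψ = ι ∘ (K → F̄)`, `ι : F̄ ≅ AlgebraicClosure F` (p467957
`fixingSubgroup_le_ker_galoisRepTorsion_of_initialThetaData`), then E-t35's transport (p467607). [claim: Mochizuki2012, status: disputed] -/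
theorem geomTorsion_rational_of_initialThetaData [(thetaCurve P F).IsElliptic] (D : InitialThetaData F K Fbar (thetaCurve P F) ℓ Pb) :
    ∀ (σ : Field.absoluteGaloisGroup K) (Q : WeierstrassCurve.geomTorsion (thetaCurve P K) (ℓ : ℤ)), σ • Q = Q := by
  haveI := D.isScalarTower
  haveI := D.isAlgClosure
  let ι : Fbar ≃ₐ[F] AlgebraicClosure F := IsAlgClosure.equiv F Fbar (AlgebraicClosure F)
  exact forall_smul_geomTorsion_eq_of_fieldRange_fixingSubgroup_le
    ((ι : Fbar →ₐ[F] AlgebraicClosure F).comp (IsScalarTower.toAlgHom F K Fbar))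
    (fixingSubgroup_le_ker_galoisRepTorsion_of_initialThetaData D ι)

/-- **[IUTchIV] p.25 l.5–7 in kernel at Def. 3.1's data**: for the `K` of ANY initial Θ-data over the Legendre curve of `λ ∈ U` with theta
field `F`, **every prime of `2·3·5·ℓ` divides `disc K`** (p489308 `thirtyL_clause_of_geomTorsion_rational` on §4's `hKℓ`; `ℓ ≥ 5` prime is
Def. 3.1 (c)). [claim: Mochizuki2012, status: disputed] -/
theorem thirtyL_clause_of_initialThetaData (hU : P.InU) (hF : IsThetaField P F) [(thetaCurve P F).IsElliptic]
    (D : InitialThetaData F K Fbar (thetaCurve P F) ℓ Pb) :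
    ∀ p ∈ (2 * 3 * 5 * ℓ).primeFactors, p ∈ (discr K).natAbs.primeFactors :=
  thirtyL_clause_of_geomTorsion_rational hU hF D.l_prime (by have := D.five_le_l; omega)
    (geomTorsion_rational_of_initialThetaData D)

end Datum

/-! ## 5. LOCATED: the E5 spine's field binder `hK` alone is met at `K := F`, where «`K ⊇ F(E_F[ℓ])`» FAILS under (P6) -/

section Located

variable {P : NFPoint} {F : Type} [Field F] [NumberField F] [Algebra P.F F]

/-- **The spine's `hK` at the bottom field**: `ker ρ̄_{E_F,ℓ} ≤ Gal(F̄/F) = Γ_F`, the fixing group of the image of `ψ := Algebra.ofId F F̄`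
(`Γ_F` fixes `F` pointwise) — the field binder `hK` of `abc_of_genuineResidualSupport` holds at `K := F` for EVERY `λ`, `F`, `ℓ`. [folklore] -/
theorem ker_le_fixingSubgroup_fieldRange_ofId (ℓ : ℕ) :
    ((thetaCurve P F).galoisRepTorsion (ℓ : ℤ)).ker ≤ (Algebra.ofId F (AlgebraicClosure F)).fieldRange.fixingSubgroup :=
  fun σ _ => (IntermediateField.mem_fixingSubgroup_iff _ _).mpr (by rintro _ ⟨x, rfl⟩; exact AlgEquiv.commutes _ x)

/-- **Under (P6), `Ker ρ̄_{E_F,ℓ} ≠ Γ_F`** for the Legendre curve over a theta field (`λ ∈ U`, `ℓ` prime): (P6) (`Cor22.CondP6`, the [GenEll]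
form of Def. 3.1 (c) «image ⊇ SL₂(𝔽_ℓ)», bridged by `imageContainsSL2_of_imageModLContainsSL2`) gives `[Γ_F : Ker ρ̄] ≥ ℓ(ℓ²−1) ≥ 6`
(p467957 `card_SL_le_index_ker_galoisRepTorsion`). [claim: Mochizuki2012, status: disputed] -/
theorem ker_galoisRepTorsion_ne_top_of_condP6 (hU : P.InU) (hF : IsThetaField P F) {ℓ : ℕ} (hℓ : ℓ.Prime) (h6 : CondP6 P ℓ) :
    ((thetaCurve P F).galoisRepTorsion (ℓ : ℤ)).ker ≠ ⊤ := by
  haveI := thetaCurve_isElliptic hU F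
  haveI : Fact ℓ.Prime := ⟨hℓ⟩
  haveI : NeZero ℓ := ⟨hℓ.ne_zero⟩
  have hSL : ImageContainsSL2 (AlgebraicClosure F) (thetaCurve P F) ℓ :=
    imageContainsSL2_of_imageModLContainsSL2 (thetaCurve P F) ℓ (h6 hU F hF)
  have hidx := card_SL_le_index_ker_galoisRepTorsion (thetaCurve P F) ℓ hSL
  intro htop
  rw [htop, Subgroup.index_top] at hidx
  have h2 : 2 ≤ ℓ := hℓ.two_le
  have h3 : 3 ≤ ℓ ^ 2 - 1 := by
    have : 4 ≤ ℓ ^ 2 := by nlinarith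
    omega
  nlinarith

/-- **LOCATED — at `K := F` the inclusion the discharge needs FAILS (`Γ_F`-currency)**: under (P6), `Gal(F̄/F) = Γ_F ≰ Ker ρ̄_{E_F,ℓ}`
(«`F ⊇ F(E_F[ℓ])`» is false) — although `K := F`, `ψ := Algebra.ofId F F̄` meets the spine's `hK`
(`ker_le_fixingSubgroup_fieldRange_ofId`). [claim: Mochizuki2012, status: disputed] -/
theorem not_le_ker_at_base_of_condP6 (hU : P.InU) (hF : IsThetaField P F) {ℓ : ℕ} (hℓ : ℓ.Prime) (h6 : CondP6 P ℓ) :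
    ¬ ((Algebra.ofId F (AlgebraicClosure F)).fieldRange.fixingSubgroup ≤ ((thetaCurve P F).galoisRepTorsion (ℓ : ℤ)).ker) :=
  fun hle => ker_galoisRepTorsion_ne_top_of_condP6 hU hF hℓ h6 (eq_top_iff.mpr fun σ _ =>
    hle ((IntermediateField.mem_fixingSubgroup_iff _ _).mpr (by rintro _ ⟨x, rfl⟩; exact AlgEquiv.commutes _ x)))

/-- **LOCATED — the same in the rows' `Γ_K`-currency at `K := F`**: under (P6) the `ℓ`-torsion of the Legendre curve over the theta field
is NOT `F`-rational (`¬ hKℓ` at `K = F`). [claim: Mochizuki2012, status: disputed] -/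
theorem not_geomTorsion_rational_at_base_of_condP6 (hU : P.InU) (hF : IsThetaField P F) {ℓ : ℕ} (hℓ : ℓ.Prime) (h6 : CondP6 P ℓ) :
    ¬ (∀ (σ : Field.absoluteGaloisGroup F) (Q : WeierstrassCurve.geomTorsion (thetaCurve P F) (ℓ : ℤ)), σ • Q = Q) :=
  fun h => not_le_ker_at_base_of_condP6 hU hF hℓ h6
    (le_ker_of_geomTorsion_rational (K := F) (Algebra.ofId F (AlgebraicClosure F)) h)

/-- **LOCATED, ∃-form matching the spine's GIVEN.** Under `ITDConditions λ ℓ` (E-t28: `7 ≤ ℓ ∧ (P2) ∧ (P5) ∧ (P6)`, GIVEN in the antecedent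
of `abc_of_genuineResidualSupport` / `_reading3` / `abc_of_genuineResidual`) the spine's field binders — a number field `K ⊇ F ⊇ F_tpd`,
`K/F` Galois, `ψ : K →ₐ[F] F̄`, `hK : ker ρ̄_{E_F,ℓ} ≤ Gal(F̄/ψ(K))` (verbatim up to the spine's vacuous `letI`) — are INHABITED, at
`K := F`, by data at which «`K ⊇ F(E_F[ℓ])`» (p486541's currency) is FALSE. So the inclusion is NOT a consequence of the E5 binders; it
is the binder `hKℓ`/`hψ` of the consumers of clause (i) (§3). [claim: Joshi2024ATS4, status: disputed] -/
theorem exists_spine_fieldBinders_not_le_ker_of_itdConditions (hU : P.InU) (hF : IsThetaField P F) {ℓ : ℕ} (hℓ : ℓ.Prime)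
    (hITD : ITDConditions P ℓ) :
    ∃ (K : Type) (_ : Field K) (_ : NumberField K) (_ : Algebra F K) (_ : Algebra P.F K) (_ : IsScalarTower P.F F K)
      (_ : IsGalois F K) (ψ : K →ₐ[F] AlgebraicClosure F),
      ((thetaCurve P F).galoisRepTorsion (ℓ : ℤ)).ker ≤ ψ.fieldRange.fixingSubgroup ∧
        ¬ (ψ.fieldRange.fixingSubgroup ≤ ((thetaCurve P F).galoisRepTorsion (ℓ : ℤ)).ker) :=
  ⟨F, inferInstance, inferInstance, inferInstance, inferInstance, inferInstance, inferInstance,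
    Algebra.ofId F (AlgebraicClosure F), ker_le_fixingSubgroup_fieldRange_ofId ℓ,
    not_le_ker_at_base_of_condP6 hU hF hℓ hITD.2.2.2⟩

end Located

end GenuineVdst

end Summit.ABC.IUTFork.Joshi.ATS4

end
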